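import Summits.BirchSwinnertonDyer.BirchSwinnertonDyer.Theorems.EisensteinPrimesAcTwistDeformationImprimCorank
import Summits.BirchSwinnertonDyer.BirchSwinnertonDyer.Theorems.EisensteinPrimesAcTwistDeformationLocSurjOfTate
import Literature.NumberTheory.IwasawaTheory.Greenberg2006.CohomologyCofiniteGenerationLeTwoOfTate
import HarnessLib

/-!
# T28 re-typing (`OfTate`) of `EisensteinPrimesAcTwistDeformationImprimCorank.lean`

Route `EisensteinPrimes` (rung K5), crux 2 `GoodLatticeBDPValue` (stmt-BirchSwinnertonDyer-19032), line `halves`;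
cell `bsd-eis`, seat `bsd-line-x1-p1` LEAD g8, lane «T28 / TATE RE-PLUMB» (helper, `--supports`).

This file re-types, token for token, the theorems of `EisensteinPrimesAcTwistDeformationImprimCorank` that carry
Greenberg 2006 Prop. 3.2 BY NAME (`h32 : (∀ (L : Type) [Field L] [NumberField L], Literature.NumberTheory.GaloisCohomology.tateGlobalEulerPoincareCharacteristic L)`, cofinite generation of
`Hⁱ(K_Σ/K, 𝒟)` / `Hⁱ(K_v, 𝒟)` for EVERY `i`, every number field, every prime) with that hypothesis replaced by
Tate's global Euler–Poincaré characteristic BY NAME for every number field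
(`h32 : ∀ L, GaloisCohomology.tateGlobalEulerPoincareCharacteristic L`, Milne ADT I Thm. 5.1): on this line
Prop. 3.2 is read in degrees `i ≤ 2` only (global clause; the local clause is the unconditional
`Greenberg2006.prop32_local_holds`), and in those degrees it follows from Tate's formula alone
(`Greenberg2006.prop32_global_le_two_of_tate`, file `CohomologyCofiniteGenerationLeTwoOfTate`: `H⁰`/`H¹` of
`G_{K,S}` with finite coefficients are finite unconditionally, `H²` by Tate, and Greenberg's dévissage for `Hⁿ`
involves `Hⁿ`, `Hⁿ⁻¹` only).  Statements are otherwise VERBATIM (same binder order, new names `<name>_ofTate`);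
proofs are the tree proofs with the two reading lemmas substituted and the re-typed callees called.
EFFECT for the crux: Harari Thm. 17.13 (a) (`poitouTate_restricted_three_le`) is no longer consumed through
Prop. 3.2 at every number field, only at totally complex fields (Greenberg 2006 Prop. 4.1 is typed totally
imaginary; `cd_p ≤ 2` and the `H²` bookkeeping at the imaginary quadratic `K`), which is what the tree's
class-formation road (`RestrictedRamificationCdTwoOfH3Mu`, lane PT3-TC) proves.

Theorems only; no definition, no named fact, no `sorry`, no instance. HONEST FRAMING: conditional on the PUBLISHED
named facts carried as hypotheses; closes nothing by itself; no summit statement / BSD / the crux is proved here.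

## References
* R. Greenberg, *On the structure of certain Galois cohomology groups*, Doc. Math. Extra Vol. Coates (2006), Prop. 3.2 (p. 358). [Greenberg2006]
* J. S. Milne, *Arithmetic Duality Theorems*, 2nd ed. (2006), I Thm. 5.1 (p. 67). [MilneADT2006]
* (the references of the re-typed file apply verbatim)
-/

set_option autoImplicit false

noncomputable section

open scoped Classical
open NumberField IsDedekindDomain Field Multiplicative PowerSeries WeierstrassCurve
open Literature.NumberTheory.EllipticCurves Literature.NumberTheory.EllipticCurves.GreenbergSelmer
  Literature.NumberTheory.EllipticCurves.GreenbergVatsal2000 Literature.NumberTheory.GaloisRepresentations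
  Literature.NumberTheory.EllipticCurves.KellerYin2024 Literature.NumberTheory.EllipticCurves.IwasawaDual
  Literature.NumberTheory.IwasawaTheory Literature.NumberTheory.IwasawaTheory.Greenberg2016
  Literature.NumberTheory.IwasawaTheory.Greenberg2006
  Summit.BirchSwinnertonDyer.BirchSwinnertonDyer.Theorems.GreenbergFullAtSelmer
  Summit.BirchSwinnertonDyer.BirchSwinnertonDyer.Theorems.AcTwistDeformationResidualPair
  Summit.BirchSwinnertonDyer.BirchSwinnertonDyer.Theorems.UnrSelmerQuotientTorsionFiniteChar

namespace Summit.BirchSwinnertonDyer.BirchSwinnertonDyer.Theorems.AcTwistDeformation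

/-- **[T28 `OfTate` re-typing: Greenberg 2006 Prop. 3.2 by name ↦ Milne ADT I Thm. 5.1 by name (Prop. 3.2 is read in degrees ≤ 2 only, `prop32_global_le_two_of_tate`).]** [cite: MilneADT2006, I Thm. 5.1 (p. 67)] **[PWL-θ] `≥` AT THE RESIDUAL PAIR, FROM THE FIVE GREENBERG FACTS.** Under Greenberg 2016 Prop. 2.6.3
(`SUR` from `LEO` + `CRK`) and Greenberg 2006 Props. 4.1, 4.2, §5 A, 3.2 (Euler–Poincaré coranks, local
duality for `H²`, cofinite generation) BY NAME, `KellerYin2024.prop125_residualPair_unrSelmer_corank_ge`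
holds: for `W/ℚ` globally minimal with `Good/Red/Anom` at `p > 2`, `K` imaginary quadratic with (Heeg) for
`N_E` and `p`, `v`/`v̄` the places above `p`, `κ` anticyclotomic with topological generator `γ`,
`θ ∈ {θsub, θquot}` the residual pair of `E[p]` over `K`, `Sf` the places over `N_E`, and [RH]
(`H¹_{𝓕_nr}(K_∞, (F/𝒪)(θ))^∨` finitely generated `Λ`-torsion with `μ = 0`):
`Σ_{w∈Sf} charLocalLambda ∅ κ θ w ≤ corank_{ℤ_p}(H¹_{𝓕_nr^{Sf}}/H¹_{𝓕_nr})`.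
[cite: Greenberg2016Selmer, Prop. 2.6.3 (§2.6 p. 10)] [cite: Greenberg2006, Props. 3.2, 4.1, 4.2, §5 A]
[cite: PollackWeston2011, App. A Prop. A.2] [cite: KellerYin2024, Prop. 1.2.5 (eq:Gr to imp), Lemma 1.1.1, Rem. 1.2.3 (ii) (arXiv:2402.12781v2 TeX L780–800, L455–462, L690–712)]
[cite: CastellaGrossiLeeSkinner2022, Prop. 1.2.5 (proof, (eq:sur1)–(eq:sur2))] [cite: SkinnerUrban2014, §3.1.2 and Prop. 3.2.3] -/
theorem prop125_residualPair_unrSelmer_corank_ge_of_facts_ofTate (h263 : prop263_sur_of_crk)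
    (h41 : prop41_globalEulerPoincareCorank) (h42 : prop42_localEulerPoincareCorank)
    (h5A : sec5A_localH2_subsingleton_of_LOC1) (h32 : (∀ (L : Type) [Field L] [NumberField L], Literature.NumberTheory.GaloisCohomology.tateGlobalEulerPoincareCharacteristic L)) :
    prop125_residualPair_unrSelmer_corank_ge := by
  intro W _ _ p _ hp hgood hred hanom hlat K _ _ hK hH hHp htor ι v vbar hvι hvbar hne κ hκ γ _ θsub θquot
    hpair Sf hSf θ hθ hRH
  have hγ : κ.IsTopGenerator γ := Fact.out
  have hv : ((p : ℕ) : 𝓞 K) ∈ v.asIdeal := IwasawaTwoVariable.natCast_mem_asIdeal_of_norm_iff hvι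
  have hpN : ¬ p ∣ W.conductorNorm ℤ := fun hd ↦
    (W.dvd_conductorNorm_iff_not_hasGoodReductionAtPrime p).mp hd hgood
  have hSfp : ∀ w ∈ Sf, ((p : ℕ) : 𝓞 K) ∉ w.asIdeal := fun w hw ↦
    GoodLatticeCorankOfGe.natCast_notMem_of_intCast_mem hpN Fact.out w ((hSf w).mp hw)
  have hSp : ∀ w : HeightOneSpectrum (𝓞 K), ((p : ℕ) : 𝓞 K) ∈ w.asIdeal → w = v ∨ w = vbar :=
    fun w hw ↦ eq_or_eq_of_natCast_mem_of_ne hK.1 hv hvbar hne hw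
  have hθpow : ∀ σ : absoluteGaloisGroup K, θ σ ^ (p - 1) = 1 := fun σ ↦ by
    rcases hθ with rfl | rfl
    · exact (hpair.pow_sub_one σ).1
    · exact (hpair.pow_sub_one σ).2
  -- every `w ∈ Sf` is finitely decomposed in `K_∞^{ac}` (Brink), with `κ(D_w) = p^{a_w} ℤ_p` exactly
  have hdec : ∀ w ∈ Sf, ¬ decomp (K := K) w ≤ κ.kerSubgroup := fun w hw hle ↦ by
    obtain ⟨δ, hδ, hne1⟩ := exists_mem_decomp_apply_ne_one_of_heegner hK hp hH κ hκ w ((hSf w).mp hw)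
      (hSfp w hw)
    exact hne1 (ZpExtension.mem_kerSubgroup.mp (hle hδ))
  have hexp : ∀ w : HeightOneSpectrum (𝓞 K), ∃ a : ℕ, w ∈ Sf →
      (∃ δ ∈ decomp (K := K) w, (κ δ).toAdd = (p : ℤ_[p]) ^ a) ∧
        ∀ δ ∈ decomp (K := K) w, (p : ℤ_[p]) ^ a ∣ (κ δ).toAdd := by
    intro w
    by_cases hw : w ∈ Sf
    · obtain ⟨c, ⟨d₀, hd₀⟩, -, hdvd⟩ :=
        UniversalToricDescentSigmaLocalStabilizer.exists_pow_and_forall_dvd_of_not_le κ w (hdec w hw)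
      exact ⟨c, fun _ ↦ ⟨⟨d₀, d₀.2, hd₀⟩, fun δ hδ ↦ hdvd ⟨δ, hδ⟩⟩⟩
    · exact ⟨0, fun h ↦ (hw h).elim⟩
  choose a ha using hexp
  have hd₀ : ∀ w ∈ Sf, ∃ δ ∈ decomp (K := K) w, (κ δ).toAdd = (p : ℤ_[p]) ^ a w :=
    fun w hw ↦ (ha w hw).1
  have hdiv : ∀ w ∈ Sf, ∀ δ ∈ decomp (K := K) w, (p : ℤ_[p]) ^ a w ∣ (κ δ).toAdd :=
    fun w hw ↦ (ha w hw).2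
  -- the representatives `γ^i` of the places above `w`: `κ(γ^i) = i`
  have hσrep : ∀ w ∈ Sf, ∀ i : ℕ, i < p ^ a w → (κ ((fun (_ : HeightOneSpectrum (𝓞 K)) (i : ℕ) ↦ γ ^ i) w i)).toAdd =
      (i : ℤ_[p]) := fun w _ i _ ↦ by
    change (κ (γ ^ i)).toAdd = (i : ℤ_[p])
    rw [map_pow, show κ γ = Multiplicative.ofAdd 1 from hγ, ← ofAdd_nsmul, toAdd_ofAdd, nsmul_one]
  -- `S = {v, v̄} ∪ Sf`; `θ` is unramified outside `S`
  have hS : ∀ w : HeightOneSpectrum (𝓞 K), ((p : ℕ) : 𝓞 K) ∈ w.asIdeal →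
      w ∈ (↑(insert v (insert vbar Sf)) : Set (HeightOneSpectrum (𝓞 K))) :=
    mem_insert_insert_of_natCast_mem hK hv hvbar hne Sf
  have hSfS : ∀ w ∈ Sf, w ∈ (↑(insert v (insert vbar Sf)) : Set (HeightOneSpectrum (𝓞 K))) :=
    fun w hw ↦ by
    rw [Finset.coe_insert, Finset.coe_insert]
    exact Or.inr (Or.inr (Finset.mem_coe.mpr hw))
  have h : ramificationSubgroup K (↑(insert v (insert vbar Sf)) : Set (HeightOneSpectrum (𝓞 K))) ≤
      (unitChar θ).toMonoidHom.ker :=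
    ramificationSubgroup_le_ker_unitChar_of_residualPair W hpair Sf hSf _ hSfS hS θ hθ
  -- the canonical (discrete) topological instances of the model
  letI tΛ : TopologicalSpace (PowerSeries ℤ_[p]) := ⊥
  haveI : DiscreteTopology (PowerSeries ℤ_[p]) := ⟨rfl⟩
  haveI : IsTopologicalRing (PowerSeries ℤ_[p]) := inferInstance
  haveI hAdisc : DiscreteTopology (QpModZp p) := QpModZp.discreteTopology p
  haveI : IsTopologicalAddGroup (BigRepModule ℤ_[p] p (QpModZp p)) := inferInstance
  haveI : ContinuousSMul (PowerSeries ℤ_[p]) (BigRepModule ℤ_[p] p (QpModZp p)) := inferInstance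
  -- the model `ρ_θ` on `ℚ_p/ℤ_p`, `ψ = (charModuleEquiv θ)⁻¹`, the Shapiro descent `F`, and [RH]
  have hψ := charModuleEquiv_symm_galois (↑(insert v (insert vbar Sf)) : Set (HeightOneSpectrum (𝓞 K))) θ h
  obtain ⟨F, hF⟩ := exists_shapiroDescent _ hS κ (characterRepUnramified _ θ h) (charModuleEquiv θ).symm hψ
  obtain ⟨hSel, hSelfg⟩ := hasCorank_fullAtSelmer_zero_of_RH hK κ hγ hv hvbar hne θ _ hS h hRH
  -- the `K_∞`-side global-to-local surjectivity (file 8)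
  have h8 : ∀ y : ∀ w : HeightOneSpectrum (𝓞 K), ℕ →
      subgroupH1 (κ.kerSubgroup ⊓ decomp (K := K) w) (charModule (∅ : Set (PadicAlgCl p)) θ),
      ∃ u ∈ unrSelmer κ (charModule (∅ : Set (PadicAlgCl p)) θ) vbar (↑Sf : Set (HeightOneSpectrum (𝓞 K))),
        ∀ w ∈ Sf, ∀ i : ℕ, i < p ^ a w →
          resOfLe (charModule (∅ : Set (PadicAlgCl p)) θ)
            (inf_le_left : κ.kerSubgroup ⊓ decomp (K := K) w ≤ κ.kerSubgroup)
            (conjH1 κ.kerSubgroup (charModule (∅ : Set (PadicAlgCl p)) θ) (γ ^ i) u) = y w i := fun y ↦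
    exists_mem_unrSelmer_forall_resOfLe_conjH1_eq_ofTate _ hS κ (characterRepUnramified _ θ h)
      (charModuleEquiv θ).symm hψ h263 h41 h42 h5A h32 (Finset.finite_toSet _) hK
      (LinearEquiv.refl ℤ_[p] (QpModZp p)) (characterRepUnramified_hscalar _ θ h)
      (exists_local_apply_ne_one_of_mem_insert_insert hK hp hH κ hκ hv hvbar Sf hSf)
      hne hv hvbar hSp hSel hSelfg (fun b ↦ QpModZp.exists_pow_nsmul_eq_zero b) hF Sf hSfS hSfp a hdiv hd₀
      (fun _ i ↦ γ ^ i) hσrep y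
  -- corank bookkeeping (width seat w2): the surjection has kernel `H¹_{𝓕_nr}`, coranks add over the
  -- `Σ_{w∈Sf} numPlacesAbove κ w` factors (`numPlacesAbove κ w = p^{a_w}`), each of corank `≥ 𝟙[θ(Frob_w) ≡ Nw]`
  exact UnrSelmerLocSurjAdapter.sum_charLocalLambda_le_zpCorank_unrSelmer_quotient_at_residualPair_of_forall_exists
    κ θ vbar Sf hK hp hH hκ hγ θsub θquot hpair hSf hSfp hθ a hdiv hd₀ (fun _ i ↦ γ ^ i) hσrep h8

end Summit.BirchSwinnertonDyer.BirchSwinnertonDyer.Theorems.AcTwistDeformation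

end
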